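import Summits.NavierStokesRegularity.FunctionalMining.StretchingFillerPlus
import Literature.Analysis.FunctionSpaces.TorusTestFunction
import HarnessLib

/-!
# K1-Q1: the planar filler nodes `PlanarFillerFamily` and `PlanarCellFamily` hold

Cell `pub-nsfunc` (host summit NavierStokesRegularity, topic `FunctionalMining`), prove seat gen 5: the two remaining
typed nodes of the dictionary seat's `StretchingNestedTargets.lean` (bank `K1Q1-HALF.md` Thm 1 / Cor. 3.1 input,
typed through statistics, with the `2½`-dimensionality made explicit). **Search for candidate a priori estimates;
no regularity claim.** Static facts about smooth fields on `T³`.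

The halved exact-plateau cellular field `v = ½u_{ε,m}` (`StretchingLowerCellular*.lean`, `StretchingFillerMinus.lean`)
has `∂₂v ≡ 0`, `|ω|² ≤ 1`, `σ(v) ≥ ¼ − ε`, `ℰ(v) ≤ ½ + ε`, `T₂₂ − T₁₁ ≥ ¼ − ε`; its coordinate swap
`x₁ ↔ x₂` (`StretchingFillerPlus.lean`) has `∂₁ ≡ 0` and the moment gap reversed. Headlines:
`planarFillerFamily_holds : PlanarFillerFamily`, `planarCellFamily_holds : PlanarCellFamily`. With
`WrapFinal.*` this discharges every `@[conjecture]` node of the K1-Q1 wrap graph except the general wrap lemma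
`WrapLowerBound` (all fillers), whose specialisation to these fillers is `nested_le_stretchingSupConst`.
-/

noncomputable section

open MeasureTheory Set Filter Topology Function
open scoped InnerProductSpace ContDiff

namespace Summit.NavierStokesRegularity.FunctionalMining

open Literature.Analysis Literature.Analysis.FunctionSpaces Literature.Analysis.FunctionSpaces.Torus
open Literature.Analysis.FluidPDE Literature.Analysis.FluidPDE.Torus

namespace PlanarFiller

open CellularStretching Confinement WrapStretching FillerMinus Swap12

/-- **The halved cellular family, `2½`-dimensional form** (`∂₂v ≡ 0`): `|ω|² ≤ 1`, `σ ≥ ¼ − ε₀`, `ℰ ≤ ½ + ε₀`,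
`T₂₂ − T₁₁ ≥ ¼ − ε₀`. [ours] -/
theorem fillerMinus_family (ε₀ : ℝ) (hε₀ : 0 < ε₀) :
    ∃ v : UnitAddTorus (Fin 3) → EuclideanSpace ℝ (Fin 3), IsSmooth v ∧ IsDivFree v ∧
      (∀ x, Torus.partialDeriv 2 v x = 0) ∧ (∀ x, torusVorticitySqAt v x ≤ 1) ∧
      1 / 4 - ε₀ ≤ enstrophyProduction v ∧ torusEnstrophy v ≤ 1 / 2 + ε₀ ∧
      1 / 4 - ε₀ ≤ vorticityMoment v 2 2 - vorticityMoment v 1 1 := by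
  -- the plateau parameter
  set ε : ℝ := min (1 / 32) (ε₀ / 64) with hεdef
  have hε : 0 < ε := lt_min (by norm_num) (by linarith)
  have hε' : ε ≤ 1 / 32 := min_le_left _ _
  have hεε : ε ≤ ε₀ / 64 := min_le_right _ _
  obtain ⟨tσ, tE, tT⟩ := tendsto_bounds hε hε'
  -- the limits beat the targets strictly
  have lσ : 1 / 4 - ε₀ < (4 * 2 * ((1 / 2 - 6 * ε) ^ 2 - 4 * ε) - 0) / 8 := by nlinarith
  have lE : (2 + 4 * 2 * (1 / 2 + 2 * ε) ^ 2 + 0) / 8 < 1 / 2 + ε₀ := by nlinarith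
  have lT : 1 / 4 - ε₀ < (2 - 8 * ε - (2 * 2 * (1 / 2 + 2 * ε) ^ 2 + 2 * 0)) / 4 := by nlinarith
  have eσ := tσ.eventually (eventually_gt_nhds lσ)
  have eE := tE.eventually (eventually_lt_nhds lE)
  have eT := tT.eventually (eventually_gt_nhds lT)
  obtain ⟨m, hm⟩ := ((eσ.and eE).and (eT.and (eventually_gt_atTop 0))).exists
  obtain ⟨⟨hmσ, hmE⟩, hmT, hm0⟩ := hm
  obtain ⟨hsup, hσ, hE, hT2, hT1⟩ := cell_stats hε hε' hm0
  -- the halved field and its potential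
  have hus : IsSmooth ((u (base hε hε') (envM hε hε') (wave hε hε' m (amp (envLip ε) m)))) := isSmooth_u _ _ _
  have hud : IsDivFree ((u (base hε hε') (envM hε hε') (wave hε hε' m (amp (envLip ε) m)))) := isDivFree_u _ _ _
  set v := (2⁻¹ : ℝ) • (u (base hε hε') (envM hε hε') (wave hε hε' m (amp (envLip ε) m))) with hv
  have hvs : IsSmooth v := hus.smul _
  have hvd : IsDivFree v := isDivFree_const_smul (hus.isContDiff (by simp)) hud _
  refine ⟨v, hvs, hvd, fun x => ?_, fun x => ?_, ?_, ?_, ?_⟩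
  · rw [hv, partialDeriv_const_smul (hus.isContDiff (by simp)), partialDeriv_two_u]; simp
  · rw [hv, torusVorticitySqAt_const_smul hus]
    have := hsup x
    nlinarith
  · rw [hv, enstrophyProduction_const_smul hus]
    have e : (2⁻¹ : ℝ) ^ 3 * enstrophyProduction ((u (base hε hε') (envM hε hε') (wave hε hε' m (amp (envLip ε) m)))) = enstrophyProduction ((u (base hε hε') (envM hε hε') (wave hε hε' m (amp (envLip ε) m)))) / 8 := by ring
    rw [e]
    have := div_le_div_of_nonneg_right hσ (by norm_num : (0 : ℝ) ≤ 8)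
    linarith
  · rw [hv, torusEnstrophy_const_smul (hus.isContDiff (by simp))]
    have e : (2⁻¹ : ℝ) ^ 2 * torusEnstrophy ((u (base hε hε') (envM hε hε') (wave hε hε' m (amp (envLip ε) m)))) = 2 * torusEnstrophy ((u (base hε hε') (envM hε hε') (wave hε hε' m (amp (envLip ε) m)))) / 8 := by ring
    rw [e]
    have := div_le_div_of_nonneg_right hE (by norm_num : (0 : ℝ) ≤ 8)
    linarith
  · rw [hv, vorticityMoment_const_smul hus, vorticityMoment_const_smul hus]
    have e : (2⁻¹ : ℝ) ^ 2 * vorticityMoment ((u (base hε hε') (envM hε hε') (wave hε hε' m (amp (envLip ε) m)))) 2 2 - (2⁻¹ : ℝ) ^ 2 * vorticityMoment ((u (base hε hε') (envM hε hε') (wave hε hε' m (amp (envLip ε) m)))) 1 1 =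
        (vorticityMoment ((u (base hε hε') (envM hε hε') (wave hε hε' m (amp (envLip ε) m)))) 2 2 - vorticityMoment ((u (base hε hε') (envM hε hε') (wave hε hε' m (amp (envLip ε) m)))) 1 1) / 4 := by ring
    rw [e]
    have h4 : (2 - 8 * ε - (2 * amp (envLip ε) m ^ 2 * (1 / 2 + 2 * ε) ^ 2 + 2 * Kc ε m (amp (envLip ε) m))) / 4 ≤
        (vorticityMoment ((u (base hε hε') (envM hε hε') (wave hε hε' m (amp (envLip ε) m)))) 2 2 - vorticityMoment ((u (base hε hε') (envM hε hε') (wave hε hε' m (amp (envLip ε) m)))) 1 1) / 4 :=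
      div_le_div_of_nonneg_right (by linarith) (by norm_num)
    linarith

/-- **`PlanarFillerFamily` holds** (tubes along `e₁`: the swapped halved cellular field, `∂₁ ≡ 0`). Search for
candidate a priori estimates; no regularity claim. [ours] -/
theorem planarFillerFamily_holds : PlanarFillerFamily := by
  intro ε hε
  obtain ⟨v, hv, hvd, hv2, hω, hσ, hE, hT⟩ := fillerMinus_family ε hε
  obtain ⟨s0, s1, s2⟩ := sw_vals
  refine ⟨swapField v, isSmooth_swapField hv, isDivFree_swapField hv hvd, ⟨1, fun x => ?_⟩, fun x => ?_, ?_, ?_, ?_⟩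
  · rw [partialDeriv_swapField hv, s1, hv2, map_zero]
  · rw [torusVorticitySqAt_swapField hv]; exact hω _
  · rw [enstrophyProduction_swapField hv hvd]; exact hσ
  · rw [torusEnstrophy_swapField hv hvd]; exact hE
  · rw [vorticityMoment_swapField hv, vorticityMoment_swapField hv, s1, s2]; exact hT

/-- **`PlanarCellFamily` holds.** [ours] -/
theorem planarCellFamily_holds : PlanarCellFamily := planarFillerFamily_holds.planarCellFamily

end PlanarFiller

end Summit.NavierStokesRegularity.FunctionalMining

end
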